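import Summits.QuantumFields.YangMills.Theses.LogConcaveChart
import Summits.QuantumFields.YangMills.Theorems.LogConcaveChartTransportIsotropic
import Summits.QuantumFields.YangMills.Theorems.LogConcaveChartTransportDensity

/-!
# Route `LogConcaveChart` — proof of the support item `TransportCovarianceTransfer`
(stmt-QuantumFields-23668), the analytic half of the transport split of crux
`QuadraticCovarianceComparison` (stmt-QuantumFields-26240)

`logConcaveChart_transportCovarianceTransfer : TransportCovarianceTransfer` — for `0 ≤ δ ≤ 1/2`,
`H₀ ≻ 0`, symmetric `H_f, H_g`, any `A` with `∫ xᵢ e^{−A} = 0` and any `C¹` map `T` pushing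
`γ_{H₀} = e^{−xᵀH₀x/2}dx / Z₀` to `e^{−A} dx / Z_A` (normalised-integral form) with `T − id`
`δ`-Lipschitz in the `H₀`-metric and `‖DT − I‖_{H₀} ≤ δ`:
`|Cov_ν(f,g) − rC| ≤ C·δ·√(rV_f rV_g)`, `C = 2√K + K/2`, `K = 3π² + π⁴/4`.

Proof = the isotropic Gaussian theorem `covariance_transport_isotropic` in the frame `y = P x`,
`P = H₀^{1/2}` (`exists_symm_sqrt`): the conjugated map `T' = P T P⁻¹` satisfies the Euclidean
hypotheses (`fderiv_conj_pinch`, `lipschitz_conj_pinch`), its displacement is `γ`-centred (from the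
centring of `e^{−A}` through the pushforward identity, `integral_conj_eq_div`), the three `γ`-integrals
are the three normalised `e^{−A}`-integrals (pushforward), and the conjugated constants
`tr((P⁻¹H_fP⁻¹)(P⁻¹H_gP⁻¹))`, `(P⁻¹b_f)·(P⁻¹b_g)` are `tr(H₀⁻¹H_fH₀⁻¹H_g)`, `b_fᵀH₀⁻¹b_g`.

HONEST SCOPE. This closes ONE SUPPORT item (the tree-provable half of a glued split).  The other
half `SandwichTransportMap` (stmt-QuantumFields-23667: existence of such a `T`, Caffarelli–Kolesnikov)
is a cited theorem-in-print and is NOT proved here; hence `QuadraticCovarianceComparison`, the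
`LogConcaveChart` thesis, rung R2a (`BalabanLadder.NT`) and every summit statement remain OPEN; the
Yang–Mills mass gap is NOT proved.  Filed by ideator seat ym-idea-8 (generation 8, lens «dual»).
-/

namespace Summit.QuantumFields.YangMills.Cruxes.TransportCovarianceTransfer

open MeasureTheory ProbabilityTheory Matrix
open scoped NNReal ENNReal

variable {n : ℕ}

/-- Linear functionals of a map with `δ`-Lipschitz displacement are `γ`-integrable. [folklore] -/
theorem integrable_dotProduct_map {δ : ℝ} {S : (Fin n → ℝ) → (Fin n → ℝ)} (hS : Continuous S)
    (hLip : ∀ x y, (S x - S y - (x - y)) ⬝ᵥ (S x - S y - (x - y)) ≤ δ ^ 2 * ((x - y) ⬝ᵥ (x - y)))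
    (w : Fin n → ℝ) :
    Integrable (fun y => w ⬝ᵥ S y) (Measure.pi fun _ : Fin n => gaussianReal 0 1) := by
  have h1 := (integrable_dotProduct_displacement (e := fun y => S y - y) (hS.sub continuous_id)
    (displacement_lipschitz hLip) w).1
  have h2 := integrable_dotProduct_pi (n := n) w
  have e : (fun y => w ⬝ᵥ S y) = fun y => w ⬝ᵥ (S y - y) + w ⬝ᵥ y := by
    funext y; rw [← dotProduct_add, sub_add_cancel]
  rw [e]
  exact h1.add h2

/-- `(M v) i = (row i of M) · v`. [folklore] -/
theorem mulVec_apply_eq_dotProduct (M : Matrix (Fin n) (Fin n) ℝ) (v : Fin n → ℝ) (i : Fin n) :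
    (M *ᵥ v) i = (fun k => M i k) ⬝ᵥ v := rfl

end Summit.QuantumFields.YangMills.Cruxes.TransportCovarianceTransfer

namespace Summit.QuantumFields.YangMills.Theorems

open MeasureTheory ProbabilityTheory Matrix
open scoped NNReal ENNReal
open Summit.QuantumFields.YangMills.Cruxes.TransportCovarianceTransfer

/-- **Transport covariance transfer** (support item stmt-QuantumFields-23668 of route
`LogConcaveChart`, child of the transport split of `QuadraticCovarianceComparison`). See the module
docstring; `SandwichTransportMap`, the parent crux, `NT` and the summit are NOT proved. [folklore] -/
theorem logConcaveChart_transportCovarianceTransfer :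
    Summit.QuantumFields.YangMills.Theses.LogConcaveChart.TransportCovarianceTransfer := by
  refine ⟨2 * Real.sqrt (3 * Real.pi ^ 2 + Real.pi ^ 4 / 4) + (3 * Real.pi ^ 2 + Real.pi ^ 4 / 4) / 2,
    fun δ hδ hδ1 n H₀ Hf Hg bf bg A T hH₀ hHf hHg hcen hT hpush hLip hD => ?_⟩
  intro gE f g rC rVf rVg
  obtain ⟨P, hPs, hP, hPP⟩ := exists_symm_sqrt hH₀
  have hQs : P⁻¹.IsSymm := isSymm_inv hPs
  have hQQ : P⁻¹ * P⁻¹ = H₀⁻¹ := by rw [← Matrix.mul_inv_rev, hPP]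
  -- the conjugated data
  have hHf' : (P⁻¹ * Hf * P⁻¹).IsSymm := isSymm_conj hQs hHf
  have hHg' : (P⁻¹ * Hg * P⁻¹).IsSymm := isSymm_conj hQs hHg
  have hT' : ContDiff ℝ 1 fun y => P *ᵥ T (P⁻¹ *ᵥ y) := contDiff_conj hT P P⁻¹
  have hT'c : Continuous fun y => P *ᵥ T (P⁻¹ *ᵥ y) := continuous_conj hT.continuous P P⁻¹
  have hD' := fderiv_conj_pinch hPs hP hPP hT hD
  have hLip' := lipschitz_conj_pinch hPs hP hPP T hLip
  -- master identity: `γ`-integrals of `F ∘ T ∘ P⁻¹` are normalised `e^{−A}`-integrals of `F`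
  have master : ∀ F : (Fin n → ℝ) → ℝ, Measurable F →
      ∫ y, F (T (P⁻¹ *ᵥ y)) ∂(Measure.pi fun _ : Fin n => gaussianReal 0 1) = gE F := by
    intro F hF
    have h := integral_conj_eq_div hPs hP hPP T fun z => F (P⁻¹ *ᵥ z)
    simp only [inv_mulVec_mulVec hP] at h
    rw [h]
    exact hpush F hF
  -- centring of the conjugated displacement
  have hTj : ∀ j : Fin n,
      Integrable (fun y => T (P⁻¹ *ᵥ y) j) (Measure.pi fun _ : Fin n => gaussianReal 0 1) ∧
        ∫ y, T (P⁻¹ *ᵥ y) j ∂(Measure.pi fun _ : Fin n => gaussianReal 0 1) = 0 := by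
    intro j
    refine ⟨?_, ?_⟩
    · have e : (fun y => T (P⁻¹ *ᵥ y) j) = fun y => (fun k => P⁻¹ j k) ⬝ᵥ (P *ᵥ T (P⁻¹ *ᵥ y)) := by
        funext y
        rw [← mulVec_apply_eq_dotProduct, inv_mulVec_mulVec hP]
      rw [e]
      exact integrable_dotProduct_map hT'c hLip' _
    · rw [master (fun x => x j) (measurable_pi_apply j)]
      show (∫ x, x j * Real.exp (-A x)) / (∫ x, Real.exp (-A x)) = 0
      rw [hcen j, zero_div]
  have hc' : ∀ i : Fin n, ∫ y, (P *ᵥ T (P⁻¹ *ᵥ y) - y) i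
      ∂(Measure.pi fun _ : Fin n => gaussianReal 0 1) = 0 := by
    intro i
    have e : (fun y : Fin n → ℝ => (P *ᵥ T (P⁻¹ *ᵥ y) - y) i) =
        fun y => (∑ j, P i j * T (P⁻¹ *ᵥ y) j) - y i := by
      funext y; rfl
    have hs : Integrable (fun y => ∑ j, P i j * T (P⁻¹ *ᵥ y) j)
        (Measure.pi fun _ : Fin n => gaussianReal 0 1) :=
      integrable_finsetSum _ fun j _ => (hTj j).1.const_mul _
    rw [e, integral_sub hs (integrable_eval_pi i), integral_finsetSum _ fun j _ => (hTj j).1.const_mul _,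
      integral_eval_pi_gaussianReal_one, sub_zero]
    refine Finset.sum_eq_zero fun j _ => ?_
    rw [integral_const_mul, (hTj j).2, mul_zero]
  -- the isotropic theorem in the frame
  have iso := covariance_transport_isotropic hδ hδ1 hHf' hHg' (P⁻¹ *ᵥ bf) (P⁻¹ *ᵥ bg) hT' hD' hLip' hc'
  simp only [quadObs_conj hQs, inv_mulVec_mulVec hP] at iso
  -- identify the three integrals and the constants
  have mf : Measurable f := (contDiff_quadObs Hf bf).continuous.measurable
  have mg : Measurable g := (contDiff_quadObs Hg bg).continuous.measurable
  have m1 : ∫ y, (T (P⁻¹ *ᵥ y) ⬝ᵥ Hf *ᵥ T (P⁻¹ *ᵥ y) + bf ⬝ᵥ T (P⁻¹ *ᵥ y)) *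
      (T (P⁻¹ *ᵥ y) ⬝ᵥ Hg *ᵥ T (P⁻¹ *ᵥ y) + bg ⬝ᵥ T (P⁻¹ *ᵥ y))
        ∂(Measure.pi fun _ : Fin n => gaussianReal 0 1) = gE (fun x => f x * g x) :=
    master (fun x => f x * g x) (mf.mul mg)
  have m2 : ∫ y, T (P⁻¹ *ᵥ y) ⬝ᵥ Hf *ᵥ T (P⁻¹ *ᵥ y) + bf ⬝ᵥ T (P⁻¹ *ᵥ y)
      ∂(Measure.pi fun _ : Fin n => gaussianReal 0 1) = gE f := master f mf
  have m3 : ∫ y, T (P⁻¹ *ᵥ y) ⬝ᵥ Hg *ᵥ T (P⁻¹ *ᵥ y) + bg ⬝ᵥ T (P⁻¹ *ᵥ y)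
      ∂(Measure.pi fun _ : Fin n => gaussianReal 0 1) = gE g := master g mg
  rw [m1, m2, m3, trace_conj_mul_conj _ _ _ _ hQQ, trace_conj_mul_conj _ _ _ _ hQQ,
    trace_conj_mul_conj _ _ _ _ hQQ, conj_dotProduct_conj hQs hQQ, conj_dotProduct_conj hQs hQQ,
    conj_dotProduct_conj hQs hQQ] at iso
  exact iso

end Summit.QuantumFields.YangMills.Theorems
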